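import Mathlib
import HarnessLib
import Literature.Analysis.FluidPDE.TypeIAncientMild
import Summits.NavierStokesRegularity.NavierStokesRegularity.Theorems.LiouvilleConjectureNS
import Summits.NavierStokesRegularity.NavierStokesRegularity.Theorems.PoloidalWindowDoorPoloidalWindowRigidityWindow
import Summits.NavierStokesRegularity.NavierStokesRegularity.Theorems.HalfSpaceWindowDoorCirculationCarryingRigidityReduction

/-!
# Route `HalfSpaceWindowDoor`, crux `CirculationCarryingRigidity` (stmt-NavierStokesRegularity-25311) is a consequence of
# the KNSS Liouville conjecture (L) — CONDITIONAL bridge (ladder placement), nothing is closed by this file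

The open research stub of crux 25311 is the `e₃`-Liouville statement `HemisphereLiouvilleE3`
(`…Reduction.stubLayerExclusion_iff_hemisphereLiouvilleE3`).  It sits BELOW the Liouville conjecture (L) of
Koch–Nadirashvili–Seregin–Šverák (canonical obligation `Summit.NavierStokesRegularity.NavierStokesRegularity.LiouvilleConjectureNS`,
item stmt-NavierStokesRegularity-10661): a profile of the route's Type-I class is a Type-I ancient mild field
(`isTypeIAncientMild_of_class`), its time shift `t ↦ v(t − δ)` is a bounded ancient mild solution in the duality sense
(`IsTypeIAncientMild.isBoundedAncientMildSolution_sub`) with continuous (hence measurable) slices, so (L) makes every slice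
spatially constant a.e., hence constant (continuity), hence curl-free — in particular `⟪curl v(s), e₃⟫ ≡ 0`, WITHOUT using the
sign hypothesis.  With the landed plumbing stub `stub_rotate` this gives the crux itself from (L).

* `hemisphereLiouvilleE3_of_liouvilleConjectureNS : LiouvilleConjectureNS → HemisphereLiouvilleE3`;
* `circulationCarryingRigidity_of_liouvilleConjectureNS : LiouvilleConjectureNS → CirculationCarryingRigidity`.

These are `conditional-result`s (hypothesis = an open conjecture); they record the dependency crux ⇐ (L) kernel-checked, as
`SlicedKelvinPlanarFluxLiouvilleOfLiouvilleConjectureNS` does for SlicedKelvin's crux 3.  Seat ns-hsw-p1 (LEAD of 25311,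
cell pub-ns-dss).  WHAT THIS IS NOT: not a proof of the crux, not a statement about Navier–Stokes regularity.
-/

noncomputable section

-- the summit and its single sub-problem share the name (CONVENTIONS §1), as in every Theorems file
set_option linter.dupNamespace false

namespace Summit.NavierStokesRegularity.NavierStokesRegularity.Theorems.HalfSpaceWindowDoorCirculationCarryingRigidityOfLiouville

open MeasureTheory Set Function Filter Topology
open scoped RealInnerProductSpace InnerProductSpace
open Literature.Analysis Literature.Analysis.FluidPDE
open Summit.NavierStokesRegularity.NavierStokesRegularity (LiouvilleConjectureNS)
open Summit.NavierStokesRegularity.NavierStokesRegularity.Theses.HalfSpaceWindowDoor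
open Summit.NavierStokesRegularity.NavierStokesRegularity.Theorems.HalfSpaceWindowDoorCirculationCarryingRigidityDefs
open Summit.NavierStokesRegularity.NavierStokesRegularity.Theorems.HalfSpaceWindowDoorCirculationCarryingRigidityReduction
  (circulationCarryingRigidity_of_hemisphereLiouvilleE3)
open Summit.NavierStokesRegularity.NavierStokesRegularity.Theorems.PoloidalWindowDoorPoloidalWindowRigidityWindow
  (isTypeIAncientMild_of_class)
open Summit.NavierStokesRegularity.NavierStokesRegularity.Theorems.LocalSineTubeDoorProfileAlignedWindowRigidityAncient
  (continuous_slice)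

/-- **The `e₃`-Liouville statement of crux 25311 follows from the Liouville conjecture (L)** (conditional bridge; the
sign hypothesis `⟪curl v, e₃⟫ ≥ 0` is not used): under (L) every slice of a profile of the route's Type-I class is
spatially constant, hence curl-free. -/
theorem hemisphereLiouvilleE3_of_liouvilleConjectureNS (hL : LiouvilleConjectureNS) : HemisphereLiouvilleE3 := by
  intro C v hrate hcont hmild hdiv _hnn s hs y
  have hA : IsTypeIAncientMild C v := isTypeIAncientMild_of_class hrate hcont hmild hdiv
  -- shift time by `δ = -s/2 > 0`: `w t = v (t - δ)` is a bounded ancient mild solution in the duality sense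
  set δ : ℝ := -s / 2 with hδ
  have hδ0 : 0 < δ := by rw [hδ]; linarith
  have hw : IsBoundedAncientMildSolution 1 (fun t => v (t - δ)) := hA.isBoundedAncientMildSolution_sub hδ0
  have hmeas : ∀ t < 0, AEStronglyMeasurable ((fun t => v (t - δ)) t) volume :=
    fun t ht => (continuous_slice hcont (show t - δ < 0 by linarith)).aestronglyMeasurable
  -- (L): the slice at the negative time `s + δ = s/2` of `w`, i.e. `v s`, is constant a.e.
  have hsδ : s + δ < 0 := by rw [hδ]; linarith
  obtain ⟨b, hb⟩ := hL (fun t => v (t - δ)) hw hmeas (s + δ) hsδ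
  have hb' : v s =ᵐ[volume] fun _ => b := by simpa only [add_sub_cancel_right] using hb
  -- continuity upgrades a.e. to everywhere, and a constant field is curl free
  have heq : v s = fun _ => b :=
    (Continuous.ae_eq_iff_eq volume (continuous_slice hcont hs) continuous_const).1 hb'
  have hcurl : curl (v s) y = 0 := by
    rw [heq]
    ext i
    fin_cases i <;> simp [curl]
  rw [hcurl, inner_zero_left]

/-- **Crux 25311 `CirculationCarryingRigidity` from the Liouville conjecture (L)** (conditional bridge): the
`e₃`-Liouville statement under (L) composed with the landed plumbing stub `stub_rotate`
(`…Reduction.circulationCarryingRigidity_of_hemisphereLiouvilleE3`). -/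
theorem circulationCarryingRigidity_of_liouvilleConjectureNS (hL : LiouvilleConjectureNS) : CirculationCarryingRigidity :=
  circulationCarryingRigidity_of_hemisphereLiouvilleE3 (hemisphereLiouvilleE3_of_liouvilleConjectureNS hL)

end Summit.NavierStokesRegularity.NavierStokesRegularity.Theorems.HalfSpaceWindowDoorCirculationCarryingRigidityOfLiouville

end
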